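import Mathlib.Algebra.Homology.DerivedCategory.Ext.ExactSequences
import Mathlib.Algebra.Homology.HomologicalComplexAbelian
import Literature.AlgebraicGeometry.Motives.FlasqueCohomology
import HarnessLib

/-!
# `Hom(P, –)` is exact on an acyclic bounded-below complex of `Ext(P, –)`-acyclic objects
# (Hartshorne III Prop. 1.2A; Weibel Cor. 5.7.7 / Ex. 2.4.3 — "acyclic objects compute derived functors")

Let `𝒜` be an abelian category, `P` an object and `C•` a cochain complex (indexed by `ℤ`) which is
ACYCLIC (exact in every degree), BOUNDED BELOW (`Cⁿ = 0` for `n < a`) and whose terms are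
`Hom(P, –)`-ACYCLIC: `Extⁱ(P, Cⁿ) = 0` for all `i ≥ 1` and all `n`. Then the complex of abelian
groups `Hom(P, C•)` is exact: every `f : P → Cⁿ` with `f ≫ d = 0` is of the form `h ≫ d` for some
`h : P → Cⁿ⁻¹` (`exists_comp_d_eq_of_acyclic_of_ext_subsingleton`). This is the dimension-shifting
argument behind "derived functors may be computed with acyclic resolutions" (R. Hartshorne,
*Algebraic Geometry*, III Prop. 1.2A; C. Weibel, *An introduction to homological algebra*,
Ex. 2.4.3): with `Zⁿ = ker dⁿ` the short exact sequences `0 → Zⁿ → Cⁿ → Zⁿ⁺¹ → 0`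
(`shortComplexCycles`, `shortExact_shortComplexCycles`) show by induction that every `Zⁿ` is again
`Hom(P, –)`-acyclic (`subsingleton_ext_cycles`), and then
`Hom(P, Cⁿ⁻¹) → Hom(P, Zⁿ) → Ext¹(P, Zⁿ⁻¹) = 0` lifts cycles to the previous term.

Typical uses (the reason this file exists): `P = ℤ[h_V]` in abelian sheaves on a scheme, `V` an
affine open, and `C•` the cone of a quasi-isomorphism from a complex of quasi-coherent modules to a
complex of injective modules (Leray's acyclicity lemma for an affine morphism); `P` a vector bundle
and `C•` a complex of modules with flasque `𝓗om(P, –)`.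

* `isZero_cycles_of_isZero`, `subsingleton_ext_of_isZero`, `subsingleton_ext_biprod` — bookkeeping;
* `shortComplexCycles K n m`, `shortExact_shortComplexCycles` — `0 → Zⁿ → Cⁿ → Zᵐ → 0`
  (`n + 1 = m`) for a complex exact in degree `m`;
* `subsingleton_ext_cycles` — `Extⁱ(P, Zⁿ) = 0`, `i ≥ 1` (dimension shifting);
* `exists_comp_toCycles_eq`, `exists_comp_d_eq_of_acyclic_of_ext_subsingleton` — the exactness of
  `Hom(P, C•)`.

Everything is proved; no named facts.

## References

* R. Hartshorne, *Algebraic Geometry*, GTM 52, Springer (1977), III Prop. 1.2A and Prop. 2.5.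
  [Hartshorne1977]
* C. A. Weibel, *An introduction to homological algebra*, Cambridge Studies in Advanced
  Mathematics 38 (1994), §1.1, Ex. 2.4.3, Prop. 3.3.4, Cor. 5.7.7. [Weibel1994]
-/

universe w v u

open CategoryTheory CategoryTheory.Abelian CategoryTheory.Limits
open Literature.AlgebraicGeometry.Motives

namespace Literature.Algebra.Homology

variable {C : Type u} [Category.{v} C] [Abelian C]

/-! ## Bookkeeping -/

/-- The cycles of a complex in a degree whose term is a zero object are a zero object.
[cite: Weibel1994, §1.1 (cycles `Zⁿ = ker dⁿ ⊆ Cⁿ`)] -/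
theorem isZero_cycles_of_isZero (K : CochainComplex C ℤ) (n : ℤ) (h : IsZero (K.X n)) :
    IsZero (K.cycles n) :=
  IsZero.of_mono (K.iCycles n) h

/-- `Ext`-groups into a zero object vanish (the empty case of `Extⁿ(A, ∏ B_β) ≅ ∏ Extⁿ(A, B_β)`).
[cite: Weibel1994, Prop. 3.3.4 (2)] -/
theorem subsingleton_ext_of_isZero [HasExt.{w} C] (P : C) {Y : C} (hY : IsZero Y) (i : ℕ) :
    Subsingleton (Ext P Y i) := by
  refine subsingleton_of_forall_eq 0 fun x => ?_
  have h1 : (𝟙 Y) = 0 := hY.eq_of_src _ _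
  rw [← Ext.comp_mk₀_id x, h1, Ext.mk₀_zero, Ext.comp_zero]

/-- `Ext`-groups into a binary biproduct vanish when they vanish into both summands (exactness of
`Extⁱ(P, A) → Extⁱ(P, A ⊞ B) → Extⁱ(P, B)` for the split short exact sequence; the binary case of
`Extⁿ(A, ∏ B_β) ≅ ∏ Extⁿ(A, B_β)`). [cite: Weibel1994, Prop. 3.3.4 (2)] -/
theorem subsingleton_ext_biprod [HasExt.{w} C] (P A B : C) (i : ℕ) [Subsingleton (Ext P A i)]
    [Subsingleton (Ext P B i)] : Subsingleton (Ext P (A ⊞ B) i) := by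
  let S : ShortComplex C := ShortComplex.mk (biprod.inl : A ⟶ A ⊞ B) (biprod.snd : A ⊞ B ⟶ B)
    biprod.inl_snd
  have hS : S.ShortExact :=
    ShortComplex.ShortExact.mk' (ShortComplex.Splitting.ofHasBinaryBiproduct A B).exact
      inferInstance inferInstance
  haveI : Subsingleton (Ext P S.X₁ i) := ‹Subsingleton (Ext P A i)›
  haveI : Subsingleton (Ext P S.X₃ i) := ‹Subsingleton (Ext P B i)›
  exact Ext.subsingleton_X₂ P hS i

/-! ## The short exact sequences `0 → Zⁿ → Cⁿ → Zⁿ⁺¹ → 0` of an acyclic complex -/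

section Cycles

variable (K : CochainComplex C ℤ)

/-- `Zⁿ ↪ Cⁿ → Zᵐ` (`n + 1 = m`): the inclusion of the cycles followed by the corestriction of the
differential to the cycles of the next degree (a short complex; short exact when `K` is exact in
degree `m`). [cite: Weibel1994, §1.1 and Ex. 2.4.3] -/
noncomputable def shortComplexCycles (n m : ℤ) : ShortComplex C :=
  ShortComplex.mk (K.iCycles n) (K.toCycles n m) (by
    rw [← cancel_mono (K.iCycles m), Category.assoc, K.toCycles_i, K.iCycles_d, zero_comp])

/-- `Zⁿ` is the kernel of `Cⁿ → Zᵐ` (the differential corestricted to the cycles, `n + 1 = m`),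
for every cochain complex. [cite: Weibel1994, §1.1] -/
noncomputable def isLimitKernelForkShortComplexCycles (n m : ℤ) (hnm : n + 1 = m) :
    IsLimit (KernelFork.ofι (K.iCycles n) (shortComplexCycles K n m).zero :
      KernelFork (K.toCycles n m)) :=
  KernelFork.IsLimit.ofι _ _
    (fun {_} k hk => K.liftCycles k m (by simp; omega) (by
      rw [← K.toCycles_i n m, ← Category.assoc, hk, zero_comp]))
    (fun {_} k hk => by simp)
    (fun {_} k hk l hl => by
      rw [← cancel_mono (K.iCycles n)]
      simpa using hl)

/-- The short complex `Zⁿ → Cⁿ → Zᵐ` is exact at `Cⁿ` (`n + 1 = m`), for every cochain complex.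
[cite: Weibel1994, §1.1] -/
theorem exact_shortComplexCycles (n m : ℤ) (hnm : n + 1 = m) : (shortComplexCycles K n m).Exact :=
  ShortComplex.exact_of_f_is_kernel _ (isLimitKernelForkShortComplexCycles K n m hnm)

/-- If `K` is exact in degree `m = n + 1`, the corestricted differential `Cⁿ → Zᵐ` is an
epimorphism. [cite: Weibel1994, §1.1 / Ex. 2.4.3] -/
theorem epi_toCycles_of_exactAt (n m : ℤ) (hnm : n + 1 = m) (h : K.ExactAt m) :
    Epi (K.toCycles n m) :=
  Preadditive.epi_of_isZero_cokernel' _ (K.homologyIsCokernel n m (by simp; omega))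
    h.isZero_homology

/-- **`0 → Zⁿ → Cⁿ → Zᵐ → 0` is short exact** (`n + 1 = m`) when `K` is exact in degree `m`.
[cite: Weibel1994, Ex. 2.4.3] [cite: Hartshorne1977, III proof of Prop. 1.2A] -/
theorem shortExact_shortComplexCycles (n m : ℤ) (hnm : n + 1 = m) (h : K.ExactAt m) :
    (shortComplexCycles K n m).ShortExact := by
  haveI : Epi (shortComplexCycles K n m).g := epi_toCycles_of_exactAt K n m hnm h
  haveI : Mono (shortComplexCycles K n m).f := by
    change Mono (K.iCycles n); infer_instance
  exact ShortComplex.ShortExact.mk' (exact_shortComplexCycles K n m hnm) inferInstance inferInstance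

end Cycles

/-! ## Dimension shifting: the cycles of an acyclic bounded-below complex of `Hom(P, –)`-acyclic
objects are `Hom(P, –)`-acyclic -/

section DimensionShifting

variable [HasExt.{w} C] (P : C) (K : CochainComplex C ℤ)

/-- One step of the dimension shifting: if `K` is exact in degree `m = n + 1`, `Extⁱ(P, Cⁿ) = 0` for
all `i ≥ 1` and `Extⁱ(P, Zⁿ) = 0` for all `i ≥ 1`, then `Extⁱ(P, Zᵐ) = 0` for all `i ≥ 1`.
[cite: Hartshorne1977, III proof of Prop. 1.2A] -/
theorem subsingleton_ext_cycles_succ (n m : ℤ) (hnm : n + 1 = m) (hK : K.ExactAt m)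
    (hX : ∀ i : ℕ, 1 ≤ i → Subsingleton (Ext P (K.X n) i))
    (hZ : ∀ i : ℕ, 1 ≤ i → Subsingleton (Ext P (K.cycles n) i)) (i : ℕ) (hi : 1 ≤ i) :
    Subsingleton (Ext P (K.cycles m) i) := by
  have hS := shortExact_shortComplexCycles K n m hnm hK
  haveI : Subsingleton (Ext P (shortComplexCycles K n m).X₂ i) := hX i hi
  haveI : Subsingleton (Ext P (shortComplexCycles K n m).X₁ (i + 1)) := hZ (i + 1) (by omega)
  exact Ext.subsingleton_X₃ P hS i

/-- **Dimension shifting.** For a cochain complex `K` which is exact in every degree, vanishes in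
degrees `< a`, and has `Extⁱ(P, Cⁿ) = 0` for all `i ≥ 1` and all `n`, every object of cycles is
`Hom(P, –)`-acyclic: `Extⁱ(P, Zⁿ) = 0` for all `i ≥ 1` and all `n`.
[cite: Hartshorne1977, III Prop. 1.2A] [cite: Weibel1994, Ex. 2.4.3] -/
theorem subsingleton_ext_cycles (hK : ∀ n, K.ExactAt n) (a : ℤ) (ha : ∀ n, n < a → IsZero (K.X n))
    (hX : ∀ (n : ℤ) (i : ℕ), 1 ≤ i → Subsingleton (Ext P (K.X n) i)) (n : ℤ) (i : ℕ) (hi : 1 ≤ i) :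
    Subsingleton (Ext P (K.cycles n) i) := by
  -- below `a` the cycles vanish; from `a - 1` on, induct
  have hbase : ∀ m, m < a → ∀ j : ℕ, 1 ≤ j → Subsingleton (Ext P (K.cycles m) j) :=
    fun m hm j _ => subsingleton_ext_of_isZero P (isZero_cycles_of_isZero K m (ha m hm)) j
  have hind : ∀ k : ℕ, ∀ j : ℕ, 1 ≤ j → Subsingleton (Ext P (K.cycles (a - 1 + k)) j) := by
    intro k
    induction k with
    | zero => intro j hj; exact hbase _ (by omega) j hj
    | succ k ih =>
      intro j hj
      exact subsingleton_ext_cycles_succ P K (a - 1 + k) (a - 1 + ((k + 1 : ℕ) : ℤ))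
        (by push_cast; ring) (hK _) (hX _) ih j hj
  by_cases hn : n < a
  · exact hbase n hn i hi
  · obtain ⟨k, hk⟩ : ∃ k : ℕ, n = a - 1 + k := ⟨(n - a + 1).toNat, by omega⟩
    rw [hk]
    exact hind k i hi

end DimensionShifting

/-! ## Exactness of `Hom(P, C•)` -/

section HomExact

variable [HasExt.{w} C] (P : C) (K : CochainComplex C ℤ)

/-- Lifting a morphism into the cycles `Zᵐ` through `Cⁿ → Zᵐ` (`n + 1 = m`) when `K` is exact in
degree `m` and `Ext¹(P, Zⁿ) = 0` (exactness of `Hom(P, Cⁿ) → Hom(P, Zᵐ) → Ext¹(P, Zⁿ)`).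
[cite: Hartshorne1977, III proof of Prop. 1.2A] -/
theorem exists_comp_toCycles_eq (n m : ℤ) (hnm : n + 1 = m) (hK : K.ExactAt m)
    [Subsingleton (Ext P (K.cycles n) 1)] (f : P ⟶ K.cycles m) :
    ∃ h : P ⟶ K.X n, h ≫ K.toCycles n m = f := by
  have hS := shortExact_shortComplexCycles K n m hnm hK
  haveI : Subsingleton (Ext P (shortComplexCycles K n m).X₁ 1) := ‹_›
  obtain ⟨x₂, hx₂⟩ := Ext.covariant_sequence_exact₃ P hS (Ext.mk₀ f) (n₁ := 1) rfl
    (Subsingleton.elim _ _)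
  refine ⟨Ext.addEquiv₀ x₂, ?_⟩
  apply (Ext.mk₀_bijective P (K.cycles m)).1
  rw [← Ext.mk₀_comp_mk₀, Ext.mk₀_addEquiv₀_apply]
  exact hx₂

/-- **`Hom(P, C•)` is exact for an acyclic bounded-below complex of `Hom(P, –)`-acyclic objects**
(Hartshorne III Prop. 1.2A / Weibel Ex. 2.4.3, the form used to compute derived functors by
acyclic resolutions): if `K` is exact in every degree, `Cⁿ = 0` for `n < a`, and `Extⁱ(P, Cⁿ) = 0`
for all `i ≥ 1` and all `n`, then every `f : P → Cᵐ` with `f ≫ d = 0` factors as `f = h ≫ d`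
through `Cⁿ`, `n + 1 = m`. [cite: Hartshorne1977, III Prop. 1.2A] [cite: Weibel1994, Ex. 2.4.3 and Cor. 5.7.7 (1), (3)] -/
theorem exists_comp_d_eq_of_acyclic_of_ext_subsingleton (hK : ∀ n, K.ExactAt n) (a : ℤ)
    (ha : ∀ n, n < a → IsZero (K.X n))
    (hX : ∀ (n : ℤ) (i : ℕ), 1 ≤ i → Subsingleton (Ext P (K.X n) i))
    (n m l : ℤ) (hnm : n + 1 = m) (hml : m + 1 = l) (f : P ⟶ K.X m) (hf : f ≫ K.d m l = 0) :
    ∃ h : P ⟶ K.X n, h ≫ K.d n m = f := by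
  -- corestrict `f` to the cycles `Zᵐ`
  let f' : P ⟶ K.cycles m := K.liftCycles f l (by simp; omega) hf
  have hf' : f' ≫ K.iCycles m = f := K.liftCycles_i f l (by simp; omega) hf
  haveI : Subsingleton (Ext P (K.cycles n) 1) :=
    subsingleton_ext_cycles P K hK a ha hX n 1 le_rfl
  obtain ⟨h, hh⟩ := exists_comp_toCycles_eq P K n m hnm (hK m) f'
  refine ⟨h, ?_⟩
  rw [← K.toCycles_i n m, ← Category.assoc, hh, hf']

/-- The same, read as the exactness of the complex of abelian groups `Hom(P, C•)` in degree `m`: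
the short complex `Hom(P, Cⁿ) → Hom(P, Cᵐ) → Hom(P, Cˡ)` (Mathlib's `preadditiveCoyoneda`
applied termwise, packaged by `HomologicalComplex.sc'`) is exact — Weibel's Cor. 5.7.7 (1)+(3) for the
left exact functor `Hom(P, –)`: an exact bounded-below complex of `Hom(P, –)`-acyclic objects has
acyclic `Hom(P, C•)`. [cite: Hartshorne1977, III Prop. 1.2A] [cite: Weibel1994, Cor. 5.7.7 (1), (3) and Ex. 2.4.3] -/
theorem coyoneda_exactAt_of_acyclic_of_ext_subsingleton (hK : ∀ n, K.ExactAt n) (a : ℤ)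
    (ha : ∀ n, n < a → IsZero (K.X n))
    (hX : ∀ (n : ℤ) (i : ℕ), 1 ≤ i → Subsingleton (Ext P (K.X n) i)) (m : ℤ) :
    (((preadditiveCoyoneda.obj (Opposite.op P)).mapHomologicalComplex (ComplexShape.up ℤ)).obj
      K).ExactAt m := by
  rw [HomologicalComplex.exactAt_iff' _ (m - 1) m (m + 1) (by simp) (by simp),
    ShortComplex.ab_exact_iff]
  intro (f : P ⟶ K.X m) (hf : f ≫ K.d m (m + 1) = 0)
  obtain ⟨h, hh⟩ := exists_comp_d_eq_of_acyclic_of_ext_subsingleton P K hK a ha hX (m - 1) m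
    (m + 1) (by omega) rfl f hf
  exact ⟨h, hh⟩

end HomExact

end Literature.Algebra.Homology
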